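import Literature.Probability.LatticeModels.PlanarIsingLogDerivative
import HarnessLib

/-!
# CHI's explicit half-plane spinor `f_{[ℍ,a;b]}`: the boundary value problem and its coefficients `𝒜_ℍ`, `𝓑_ℍ`

Topic `Literature/Probability/LatticeModels`. Continuum layer of the programme behind
`Literature.Probability.LatticeModels.chi_onePoint_rho` (Chelkak–Hongler–Izyurov 2015, "CHI15").
CHI15 §2.7.2, eq. (2.20) (p. 15 of arXiv:1202.2838v2) write down the holomorphic spinor
`f_{[ℍ,a;b]}(z) = (2i Im a)^{1/2} / (|b-ā|+|b-a|) ·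
  ([(b̄-ā)(b̄-a)]^{1/2}(z-b) + [(b-a)(b-ā)]^{1/2}(z-b̄)) / [(z-a)(z-ā)(z-b)(z-b̄)]^{1/2}`
and state that "one can check" that it solves the Riemann boundary value problem of Def. 2.8,
(2.13) `Im[f √ν_out] = 0` on `∂ℍ`, (2.14) `lim_{z→b} √(z-b) f ∈ iℝ`, (2.15) `lim_{z→a} √(z-a) f = 1`,
that its expansion at `a` (Def. 2.11, `f = 1/√(z-a) + 2𝒜√(z-a) + …`) has the coefficient `𝒜_ℍ(a;b)`
printed on p. 16 (the tree's `ACHI_H`, `PlanarIsingLogDerivative.lean`), and that its expansion at `b`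
gives `𝓑_ℍ(a;b) = (4 Im a Im b)^{1/2}/(|b-ā|+|b-a|)` (the tree's `bCHI`).

Everything here is about the **square** `f²`, which is an honest rational function: with the branch
choice `[(b-a)(b-ā)]^{1/2} = conj [(b̄-ā)(b̄-a)]^{1/2}` (the one for which the printed claims hold —
any of the two signs), the square of the numerator is branch-free
(`spinorNumSq_eq_sq`), and the three conditions of Def. 2.8 and both expansions become statements
about `f²` (squaring `Im w = 0 ⇔ w² ≥ 0`, `w ∈ iℝ ⇔ w² ≤ 0`):

* `spinorSqCHI a b z = f_{[ℍ,a;b]}(z)²` (definition, via `spinorNumSq`, `spinorC2 = 2i Im a/(|b-ā|+|b-a|)²`);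
* `spinorSqCHI_boundary` — (2.13) on `∂ℍ = ℝ` (`ν_out = -i`): `f(x)² · (-i)` is a non-negative real;
* `tendsto_spinorSqCHI_mul_sub_left` — (2.15): `(z-a) f(z)² → 1` as `z → a`;
* `hasDerivAt_spinorSqCHI_mul_sub_left` — Def. 2.11: `(z-a) f(z)² = 1 + 4𝒜_ℍ(a;b)(z-a) + O((z-a)²)`,
  i.e. the derivative at `a` of (the analytic continuation of) `(z-a)f²` is `4 · ACHI_H a b` — the
  square of `f√(z-a) = 1 + 2𝒜(z-a) + …`; this certifies the printed formula for `𝒜_ℍ` (p. 16);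
* `tendsto_spinorSqCHI_mul_sub_right` — (2.14) and the expansion at `b`:
  `(z-b) f(z)² → -𝓑_ℍ(a;b)²` with `𝓑_ℍ(a;b)² = bCHI a b ^ 2 = (|b-ā|-|b-a|)/(|b-ā|+|b-a|)` (`bCHI_sq`).

All statements are proved; no named facts. (Holomorphy of `f²` off `{a, ā, b, b̄}` is that of a
rational function; the uniqueness part of Def. 2.8, Remark 2.9 (i), is not treated here.)

## References

* D. Chelkak, C. Hongler, K. Izyurov, Ann. of Math. 181 (2015) = arXiv:1202.2838: Def. 2.8
  (eqs. (2.13)–(2.15)), Def. 2.11, §2.7.2 eq. (2.20) and the formulas for `𝓑_ℍ`, `𝒜_ℍ` (pp. 15–16)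
  — `ChelkakHonglerIzyurovAnnals2015`.
-/

noncomputable section

open Filter Topology Metric Set Real Complex
open Literature.Probability.LatticeModels

namespace Literature.Probability.LatticeModels

/-! ### The square of the explicit spinor, branch-free -/

/-- `(b̄ - ā)(b̄ - a)`, the radicand of the first coefficient of (2.20).
[cite: ChelkakHonglerIzyurovAnnals2015, §2.7.2 eq. (2.20)] -/
def spinorA2 (a b : ℂ) : ℂ := ((starRingEnd ℂ) b - (starRingEnd ℂ) a) * ((starRingEnd ℂ) b - a)

/-- `|b - a| · |b - ā| = |(b̄ - ā)(b̄ - a)|`, the modulus of both coefficients of (2.20).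
[cite: ChelkakHonglerIzyurovAnnals2015, §2.7.2 eq. (2.20)] -/
def spinorM (a b : ℂ) : ℝ := ‖b - a‖ * ‖b - (starRingEnd ℂ) a‖

/-- The **square of the numerator** of (2.20), `(α(z-b) + ᾱ(z-b̄))²` with `α² = (b̄-ā)(b̄-a)`,
written without square roots: `α²(z-b)² + 2|α|²(z-b)(z-b̄) + ᾱ²(z-b̄)²` (`spinorNumSq_eq_sq`).
[cite: ChelkakHonglerIzyurovAnnals2015, §2.7.2 eq. (2.20)] -/
def spinorNumSq (a b z : ℂ) : ℂ :=
  spinorA2 a b * (z - b) ^ 2 + 2 * (spinorM a b : ℂ) * ((z - b) * (z - (starRingEnd ℂ) b)) +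
    (starRingEnd ℂ) (spinorA2 a b) * (z - (starRingEnd ℂ) b) ^ 2

/-- The square of the prefactor of (2.20): `((2i Im a)^{1/2}/(|b-ā|+|b-a|))² = (a - ā)/(|b-ā|+|b-a|)²`.
[cite: ChelkakHonglerIzyurovAnnals2015, §2.7.2 eq. (2.20)] -/
def spinorC2 (a b : ℂ) : ℂ :=
  (a - (starRingEnd ℂ) a) / (((‖b - (starRingEnd ℂ) a‖ + ‖b - a‖) ^ 2 : ℝ) : ℂ)

/-- **The square `f_{[ℍ,a;b]}(z)²` of CHI's explicit half-plane spinor (2.20)** — a rational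
function of `z` with simple poles at `a, ā, b, b̄`.
[cite: ChelkakHonglerIzyurovAnnals2015, §2.7.2 eq. (2.20)] -/
def spinorSqCHI (a b z : ℂ) : ℂ :=
  spinorC2 a b * spinorNumSq a b z /
    ((z - a) * (z - (starRingEnd ℂ) a) * (z - b) * (z - (starRingEnd ℂ) b))

/-! ### Elementary identities -/

/-- `|(b̄ - ā)(b̄ - a)| = |b - a| |b - ā|`. [folklore] -/
theorem norm_spinorA2 (a b : ℂ) : ‖spinorA2 a b‖ = spinorM a b := by
  unfold spinorA2 spinorM
  rw [norm_mul, ← map_sub, Complex.norm_conj]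
  rw [← Complex.norm_conj (b - (starRingEnd ℂ) a), map_sub, Complex.conj_conj]

/-- `|b - a|² = (b - a)(b̄ - ā)` as complex numbers. [folklore] -/
theorem normSq_sub_cast (a b : ℂ) :
    (((‖b - a‖ ^ 2 : ℝ)) : ℂ) = (b - a) * ((starRingEnd ℂ) b - (starRingEnd ℂ) a) := by
  rw [← map_sub, Complex.mul_conj, Complex.normSq_eq_norm_sq]

/-- `|b - ā|² = (b - ā)(b̄ - a)` as complex numbers. [folklore] -/
theorem normSq_sub_conj_cast (a b : ℂ) :
    (((‖b - (starRingEnd ℂ) a‖ ^ 2 : ℝ)) : ℂ) = (b - (starRingEnd ℂ) a) * ((starRingEnd ℂ) b - a) := by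
  have h := normSq_sub_cast ((starRingEnd ℂ) a) b
  rwa [Complex.conj_conj] at h

/-- `|b - ā|² - |b - a|² = 4 Im a Im b`, in the complex form `(a - ā)(b - b̄) = |b-a|² - |b-ā|²`.
[folklore] -/
theorem sub_conj_mul_sub_conj (a b : ℂ) :
    (a - (starRingEnd ℂ) a) * (b - (starRingEnd ℂ) b) =
      (((‖b - a‖ ^ 2 : ℝ)) : ℂ) - (((‖b - (starRingEnd ℂ) a‖ ^ 2 : ℝ)) : ℂ) := by
  rw [normSq_sub_cast, normSq_sub_conj_cast]
  ring

/-- In `ℍ`, `|b - a| < |b - ā|`. [folklore] -/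
theorem norm_sub_lt_norm_sub_conj {a b : ℂ} (ha : 0 < a.im) (hb : 0 < b.im) :
    ‖b - a‖ < ‖b - (starRingEnd ℂ) a‖ := by
  have h1 : ‖b - a‖ ^ 2 < ‖b - (starRingEnd ℂ) a‖ ^ 2 := by
    rw [← Complex.normSq_eq_norm_sq, ← Complex.normSq_eq_norm_sq, Complex.normSq_apply,
      Complex.normSq_apply]
    simp only [Complex.sub_re, Complex.sub_im, Complex.conj_re, Complex.conj_im]
    nlinarith
  exact lt_of_pow_lt_pow_left₀ 2 (norm_nonneg _) h1

/-- **The numerator squared is a square**: for any square root `α` of `(b̄-ā)(b̄-a)`,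
`(α(z-b) + ᾱ(z-b̄))² = spinorNumSq a b z` — the branch choice `[(b-a)(b-ā)]^{1/2} = ᾱ` of (2.20).
[cite: ChelkakHonglerIzyurovAnnals2015, §2.7.2 eq. (2.20)] -/
theorem spinorNumSq_eq_sq {a b α : ℂ} (hα : α ^ 2 = spinorA2 a b) (z : ℂ) :
    (α * (z - b) + (starRingEnd ℂ) α * (z - (starRingEnd ℂ) b)) ^ 2 = spinorNumSq a b z := by
  have hM : α * (starRingEnd ℂ) α = (spinorM a b : ℂ) := by
    rw [Complex.mul_conj, Complex.normSq_eq_norm_sq, ← norm_pow, hα, norm_spinorA2]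
  have hc : (starRingEnd ℂ) α ^ 2 = (starRingEnd ℂ) (spinorA2 a b) := by rw [← hα, map_pow]
  unfold spinorNumSq
  rw [← hc, ← hα, ← hM]
  ring

/-! ### The boundary condition (2.13) on `∂ℍ` -/

/-- The numerator squared is a non-negative real on the real axis:
`spinorNumSq a b x = 2 Re[(b̄-ā)(b̄-a)(x-b)²] + 2|b-a||b-ā||x-b|² ≥ 0`. [folklore] -/
theorem spinorNumSq_ofReal (a b : ℂ) (x : ℝ) :
    spinorNumSq a b x = ((2 * (spinorA2 a b * ((x : ℂ) - b) ^ 2).re + 2 * spinorM a b * ‖(x : ℂ) - b‖ ^ 2 : ℝ) : ℂ) ∧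
      0 ≤ 2 * (spinorA2 a b * ((x : ℂ) - b) ^ 2).re + 2 * spinorM a b * ‖(x : ℂ) - b‖ ^ 2 := by
  have hxb : (x : ℂ) - (starRingEnd ℂ) b = (starRingEnd ℂ) ((x : ℂ) - b) := by
    rw [map_sub, Complex.conj_ofReal]
  constructor
  · unfold spinorNumSq
    rw [hxb, ← map_pow, ← map_mul, Complex.mul_conj, Complex.normSq_eq_norm_sq]
    set w : ℂ := spinorA2 a b * ((x : ℂ) - b) ^ 2 with hw
    have hw' : w + (starRingEnd ℂ) w = ((2 * w.re : ℝ) : ℂ) := Complex.add_conj w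
    push_cast at hw' ⊢
    linear_combination hw'
  · have h1 : |(spinorA2 a b * ((x : ℂ) - b) ^ 2).re| ≤ spinorM a b * ‖(x : ℂ) - b‖ ^ 2 := by
      calc |(spinorA2 a b * ((x : ℂ) - b) ^ 2).re| ≤ ‖spinorA2 a b * ((x : ℂ) - b) ^ 2‖ :=
            Complex.abs_re_le_norm _
        _ = spinorM a b * ‖(x : ℂ) - b‖ ^ 2 := by rw [norm_mul, norm_pow, norm_spinorA2]
    have h2 := neg_abs_le (spinorA2 a b * ((x : ℂ) - b) ^ 2).re
    linarith

/-- **(2.13) for `f_{[ℍ,a;b]}`**: on `∂ℍ = ℝ`, where the outer normal is `ν_out = -i`,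
`f(x)² · ν_out(x)` is a non-negative real number, i.e. `Im[f(x) √ν_out] = 0` (CHI15 Def. 2.8,
first condition, squared). [cite: ChelkakHonglerIzyurovAnnals2015, Def. 2.8 eq. (2.13) and §2.7.2] -/
theorem spinorSqCHI_boundary {a b : ℂ} (ha : 0 < a.im) (hb : 0 < b.im) (x : ℝ) :
    ∃ t : ℝ, 0 ≤ t ∧ spinorSqCHI a b x * (-I) = t := by
  obtain ⟨hN, hN0⟩ := spinorNumSq_ofReal a b x
  set N : ℝ := 2 * (spinorA2 a b * ((x : ℂ) - b) ^ 2).re + 2 * spinorM a b * ‖(x : ℂ) - b‖ ^ 2 with hNdef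
  have hxa : ((x : ℂ) - a) * ((x : ℂ) - (starRingEnd ℂ) a) = ((‖(x : ℂ) - a‖ ^ 2 : ℝ) : ℂ) := by
    rw [show (x : ℂ) - (starRingEnd ℂ) a = (starRingEnd ℂ) ((x : ℂ) - a) by
      rw [map_sub, Complex.conj_ofReal], Complex.mul_conj, Complex.normSq_eq_norm_sq]
  have hxb : ((x : ℂ) - b) * ((x : ℂ) - (starRingEnd ℂ) b) = ((‖(x : ℂ) - b‖ ^ 2 : ℝ) : ℂ) := by
    rw [show (x : ℂ) - (starRingEnd ℂ) b = (starRingEnd ℂ) ((x : ℂ) - b) by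
      rw [map_sub, Complex.conj_ofReal], Complex.mul_conj, Complex.normSq_eq_norm_sq]
  have hda : 0 < ‖(x : ℂ) - a‖ := by
    refine norm_pos_iff.2 (sub_ne_zero.2 fun h => ?_)
    have := congrArg Complex.im h; simp at this; linarith
  have hdb : 0 < ‖(x : ℂ) - b‖ := by
    refine norm_pos_iff.2 (sub_ne_zero.2 fun h => ?_)
    have := congrArg Complex.im h; simp at this; linarith
  have hSpos : 0 < ‖b - (starRingEnd ℂ) a‖ + ‖b - a‖ := by
    have := norm_sub_lt_norm_sub_conj ha hb
    have h0 : 0 ≤ ‖b - a‖ := norm_nonneg _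
    linarith
  have hCI : (a - (starRingEnd ℂ) a) * (-I) = ((2 * a.im : ℝ) : ℂ) := by
    rw [Complex.sub_conj, mul_assoc, mul_neg, Complex.I_mul_I, neg_neg, mul_one]
  refine ⟨2 * a.im * N / ((‖b - (starRingEnd ℂ) a‖ + ‖b - a‖) ^ 2 * (‖(x : ℂ) - a‖ ^ 2 * ‖(x : ℂ) - b‖ ^ 2)),
    by positivity, ?_⟩
  unfold spinorSqCHI spinorC2
  rw [hN, show ((x : ℂ) - a) * ((x : ℂ) - (starRingEnd ℂ) a) * ((x : ℂ) - b) * ((x : ℂ) - (starRingEnd ℂ) b) =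
      ((‖(x : ℂ) - a‖ ^ 2 : ℝ) : ℂ) * ((‖(x : ℂ) - b‖ ^ 2 : ℝ) : ℂ) by rw [← hxa, ← hxb]; ring]
  rw [show (a - (starRingEnd ℂ) a) / ((((‖b - (starRingEnd ℂ) a‖ + ‖b - a‖) ^ 2 : ℝ)) : ℂ) * (N : ℂ) /
        (((‖(x : ℂ) - a‖ ^ 2 : ℝ) : ℂ) * ((‖(x : ℂ) - b‖ ^ 2 : ℝ) : ℂ)) * (-I) =
      (a - (starRingEnd ℂ) a) * (-I) * (N : ℂ) /
        (((((‖b - (starRingEnd ℂ) a‖ + ‖b - a‖) ^ 2 : ℝ)) : ℂ) *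
          (((‖(x : ℂ) - a‖ ^ 2 : ℝ) : ℂ) * ((‖(x : ℂ) - b‖ ^ 2 : ℝ) : ℂ))) by ring, hCI]
  push_cast
  ring

/-! ### The expansions at `a` and at `b` -/

section Expansions

variable {a b : ℂ}

/-- The value of the numerator squared at `a`: `spinorNumSq a b a = (b-a)(b̄-a)(|b-ā|+|b-a|)²`. [folklore] -/
theorem spinorNumSq_left (a b : ℂ) :
    spinorNumSq a b a = (b - a) * ((starRingEnd ℂ) b - a) * (((‖b - (starRingEnd ℂ) a‖ + ‖b - a‖) ^ 2 : ℝ) : ℂ) := by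
  have hP := normSq_sub_cast a b
  have hR := normSq_sub_conj_cast a b
  unfold spinorNumSq spinorA2 spinorM
  push_cast
  rw [map_mul, map_sub, map_sub, Complex.conj_conj, Complex.conj_conj]
  push_cast at hP hR
  linear_combination (-((b - a) * ((starRingEnd ℂ) b - a))) * hP + (-((b - a) * ((starRingEnd ℂ) b - a))) * hR

/-- The value of the numerator squared at `b`: `spinorNumSq a b b = (b-a)(b-ā)(b-b̄)²`. [folklore] -/
theorem spinorNumSq_right (a b : ℂ) :
    spinorNumSq a b b = (b - a) * (b - (starRingEnd ℂ) a) * (b - (starRingEnd ℂ) b) ^ 2 := by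
  unfold spinorNumSq spinorA2
  rw [map_mul, map_sub, map_sub, Complex.conj_conj, Complex.conj_conj]
  ring

/-- The derivative of the numerator squared at `a`:
`-2(|b-ā|+|b-a|)(|b-a|(b̄-a) + |b-ā|(b-a))`. [folklore] -/
theorem hasDerivAt_spinorNumSq_left (a b : ℂ) :
    HasDerivAt (spinorNumSq a b)
      (-2 * ((‖b - (starRingEnd ℂ) a‖ + ‖b - a‖ : ℝ) : ℂ) *
        ((‖b - a‖ : ℂ) * ((starRingEnd ℂ) b - a) + (‖b - (starRingEnd ℂ) a‖ : ℂ) * (b - a))) a := by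
  have h1 : HasDerivAt (fun z : ℂ => (z - b) ^ 2) (2 * (a - b)) a := by
    simpa using ((hasDerivAt_id' a).sub_const b).fun_pow 2
  have h2 : HasDerivAt (fun z : ℂ => (z - (starRingEnd ℂ) b) ^ 2) (2 * (a - (starRingEnd ℂ) b)) a := by
    simpa using ((hasDerivAt_id' a).sub_const ((starRingEnd ℂ) b)).fun_pow 2
  have h3 : HasDerivAt (fun z : ℂ => (z - b) * (z - (starRingEnd ℂ) b))
      ((a - (starRingEnd ℂ) b) + (a - b)) a := by
    simpa using ((hasDerivAt_id' a).sub_const b).fun_mul ((hasDerivAt_id' a).sub_const ((starRingEnd ℂ) b))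
  have h := ((h1.const_mul (spinorA2 a b)).fun_add (h3.const_mul (2 * (spinorM a b : ℂ)))).fun_add
    (h2.const_mul ((starRingEnd ℂ) (spinorA2 a b)))
  have h' : HasDerivAt (spinorNumSq a b) _ a := h
  have hP := normSq_sub_cast a b
  have hR := normSq_sub_conj_cast a b
  refine h'.congr_deriv ?_
  unfold spinorA2 spinorM
  push_cast
  rw [map_mul, map_sub, map_sub, Complex.conj_conj, Complex.conj_conj]
  push_cast at hP hR
  linear_combination (2 * ((starRingEnd ℂ) b - a)) * hP + (2 * (b - a)) * hR

/-- The analytic continuation `g(z) = C² · spinorNumSq(z) / ((z-ā)(z-b)(z-b̄))` of `(z-a) f(z)²`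
across `a`. [cite: ChelkakHonglerIzyurovAnnals2015, Def. 2.11 and §2.7.2] -/
def spinorSqMulLeft (a b z : ℂ) : ℂ :=
  spinorC2 a b * spinorNumSq a b z / ((z - (starRingEnd ℂ) a) * (z - b) * (z - (starRingEnd ℂ) b))

/-- Off `a`, `(z-a) f(z)² = spinorSqMulLeft a b z`. [folklore] -/
theorem spinorSqCHI_mul_sub_left {z : ℂ} (hz : z ≠ a) :
    spinorSqCHI a b z * (z - a) = spinorSqMulLeft a b z := by
  unfold spinorSqCHI spinorSqMulLeft
  have hz' : z - a ≠ 0 := sub_ne_zero.2 hz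
  by_cases hD : (z - (starRingEnd ℂ) a) * (z - b) * (z - (starRingEnd ℂ) b) = 0
  · have : (z - a) * (z - (starRingEnd ℂ) a) * (z - b) * (z - (starRingEnd ℂ) b) = 0 := by
      calc (z - a) * (z - (starRingEnd ℂ) a) * (z - b) * (z - (starRingEnd ℂ) b)
          = (z - a) * ((z - (starRingEnd ℂ) a) * (z - b) * (z - (starRingEnd ℂ) b)) := by ring
        _ = 0 := by rw [hD, mul_zero]
    simp [hD, this]
  · field_simp
    try ring

/-- Non-vanishing of the basic quantities for `a, b ∈ ℍ`, `a ≠ b`. [folklore] -/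
theorem spinor_ne_zero_aux (ha : 0 < a.im) (hb : 0 < b.im) (hab : a ≠ b) :
    a - (starRingEnd ℂ) a ≠ 0 ∧ b - a ≠ 0 ∧ (starRingEnd ℂ) b - a ≠ 0 ∧ b - (starRingEnd ℂ) a ≠ 0 ∧
      b - (starRingEnd ℂ) b ≠ 0 ∧ 0 < ‖b - (starRingEnd ℂ) a‖ + ‖b - a‖ := by
  refine ⟨?_, sub_ne_zero.2 (Ne.symm hab), ?_, ?_, ?_, ?_⟩
  · rw [Complex.sub_conj]; simp [ha.ne']
  · refine sub_ne_zero.2 fun h => ?_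
    have := congrArg Complex.im h; simp at this; linarith
  · refine sub_ne_zero.2 fun h => ?_
    have := congrArg Complex.im h; simp at this; linarith
  · rw [Complex.sub_conj]; simp [hb.ne']
  · have := norm_sub_lt_norm_sub_conj ha hb
    have h0 : 0 ≤ ‖b - a‖ := norm_nonneg _
    linarith

/-- **(2.15): the normalisation at `a`.** The continuation of `(z-a)f(z)²` takes the value `1` at
`a` ("`lim_{z→a} √(z-a) f = 1`", squared). [cite: ChelkakHonglerIzyurovAnnals2015, Def. 2.8 eq. (2.15) and §2.7.2 eq. (2.20)] -/
theorem spinorSqMulLeft_left (ha : 0 < a.im) (hb : 0 < b.im) (hab : a ≠ b) :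
    spinorSqMulLeft a b a = 1 := by
  obtain ⟨h1, h2, h3, h4, h5, hS⟩ := spinor_ne_zero_aux ha hb hab
  have hS' : (((‖b - (starRingEnd ℂ) a‖ + ‖b - a‖) ^ 2 : ℝ) : ℂ) ≠ 0 := by
    exact_mod_cast (pow_pos hS 2).ne'
  unfold spinorSqMulLeft spinorC2
  rw [spinorNumSq_left]
  have h2' : a - b ≠ 0 := fun h => h2 (by rw [← neg_sub, h, neg_zero])
  have h3' : a - (starRingEnd ℂ) b ≠ 0 := fun h => h3 (by rw [← neg_sub, h, neg_zero])
  field_simp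
  ring

/-- **(2.15), limit form**: `(z-a) f_{[ℍ,a;b]}(z)² → 1` as `z → a`.
[cite: ChelkakHonglerIzyurovAnnals2015, Def. 2.8 eq. (2.15) and §2.7.2] -/
theorem tendsto_spinorSqCHI_mul_sub_left (ha : 0 < a.im) (hb : 0 < b.im) (hab : a ≠ b) :
    Tendsto (fun z => spinorSqCHI a b z * (z - a)) (𝓝[≠] a) (𝓝 1) := by
  obtain ⟨h1, h2, h3, h4, h5, hS⟩ := spinor_ne_zero_aux ha hb hab
  have hcont : ContinuousAt (spinorSqMulLeft a b) a := by
    unfold spinorSqMulLeft spinorNumSq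
    have hden : (a - (starRingEnd ℂ) a) * (a - b) * (a - (starRingEnd ℂ) b) ≠ 0 := by
      have h2' : a - b ≠ 0 := fun h => h2 (by rw [← neg_sub, h, neg_zero])
      have h3' : a - (starRingEnd ℂ) b ≠ 0 := fun h => h3 (by rw [← neg_sub, h, neg_zero])
      exact mul_ne_zero (mul_ne_zero h1 h2') h3'
    exact ContinuousAt.div (by fun_prop) (by fun_prop) hden
  have h := hcont.tendsto.mono_left (nhdsWithin_le_nhds (s := ({a}ᶜ : Set ℂ)))
  rw [spinorSqMulLeft_left ha hb hab] at h
  refine h.congr' ?_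
  filter_upwards [self_mem_nhdsWithin] with z hz
  exact (spinorSqCHI_mul_sub_left hz).symm

/-- **Definition 2.11 for `f_{[ℍ,a;b]}`: the coefficient `𝒜_ℍ(a;b)` is the printed one.**
The continuation of `(z-a) f(z)²` has derivative `4 𝒜_ℍ(a;b)` at `a`, i.e.
`(z-a)f² = 1 + 4𝒜_ℍ(a;b)(z-a) + O((z-a)²)` — the square of CHI's expansion
`√(z-a) f = 1 + 2𝒜(z-a) + …` — with `𝒜_ℍ(a;b) = ACHI_H a b`, the formula of p. 16.
[cite: ChelkakHonglerIzyurovAnnals2015, Def. 2.11 and §2.7.2 (formula for 𝒜_ℍ(a;b), p. 16)] -/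
theorem hasDerivAt_spinorSqMulLeft (ha : 0 < a.im) (hb : 0 < b.im) (hab : a ≠ b) :
    HasDerivAt (spinorSqMulLeft a b) (4 * ACHI_H a b) a := by
  obtain ⟨h1, h2, h3, h4, h5, hS⟩ := spinor_ne_zero_aux ha hb hab
  have h2' : a - b ≠ 0 := fun h => h2 (by rw [← neg_sub, h, neg_zero])
  have h3' : a - (starRingEnd ℂ) b ≠ 0 := fun h => h3 (by rw [← neg_sub, h, neg_zero])
  have hS' : (((‖b - (starRingEnd ℂ) a‖ + ‖b - a‖) ^ 2 : ℝ) : ℂ) ≠ 0 := by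
    exact_mod_cast (pow_pos hS 2).ne'
  have hS'' : ((‖b - (starRingEnd ℂ) a‖ + ‖b - a‖ : ℝ) : ℂ) ≠ 0 := by exact_mod_cast hS.ne'
  -- the denominator and its derivative
  have hden : HasDerivAt (fun z : ℂ => (z - (starRingEnd ℂ) a) * (z - b) * (z - (starRingEnd ℂ) b))
      (((a - b) + (a - (starRingEnd ℂ) a)) * (a - (starRingEnd ℂ) b) +
        (a - (starRingEnd ℂ) a) * (a - b)) a := by
    have := (((hasDerivAt_id' a).sub_const ((starRingEnd ℂ) a)).fun_mul ((hasDerivAt_id' a).sub_const b)).fun_mul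
      ((hasDerivAt_id' a).sub_const ((starRingEnd ℂ) b))
    simpa using this
  have hden0 : (a - (starRingEnd ℂ) a) * (a - b) * (a - (starRingEnd ℂ) b) ≠ 0 :=
    mul_ne_zero (mul_ne_zero h1 h2') h3'
  have hnum := (hasDerivAt_spinorNumSq_left a b).const_mul (spinorC2 a b)
  have h : HasDerivAt (spinorSqMulLeft a b) _ a := hnum.div hden hden0
  refine h.congr_deriv ?_
  -- algebra: the quotient-rule expression equals `4 𝒜_ℍ(a;b)`
  rw [spinorNumSq_left]
  have hconj : a - (starRingEnd ℂ) a = ((2 * a.im : ℝ) : ℂ) * I := Complex.sub_conj a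
  have him : (8 * I * (a.im : ℂ)) = 4 * (a - (starRingEnd ℂ) a) := by
    rw [hconj]; push_cast; ring
  unfold ACHI_H spinorC2
  rw [him]
  push_cast at hS' hS'' ⊢
  field_simp
  ring

/-- The analytic continuation `C² · spinorNumSq(z) / ((z-a)(z-ā)(z-b̄))` of `(z-b) f(z)²` across `b`.
[cite: ChelkakHonglerIzyurovAnnals2015, §2.7.2 (expansion at b)] -/
def spinorSqMulRight (a b z : ℂ) : ℂ :=
  spinorC2 a b * spinorNumSq a b z / ((z - a) * (z - (starRingEnd ℂ) a) * (z - (starRingEnd ℂ) b))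

/-- Off `b`, `(z-b) f(z)² = spinorSqMulRight a b z`. [folklore] -/
theorem spinorSqCHI_mul_sub_right {z : ℂ} (hz : z ≠ b) :
    spinorSqCHI a b z * (z - b) = spinorSqMulRight a b z := by
  unfold spinorSqCHI spinorSqMulRight
  have hz' : z - b ≠ 0 := sub_ne_zero.2 hz
  by_cases hD : (z - a) * (z - (starRingEnd ℂ) a) * (z - (starRingEnd ℂ) b) = 0
  · have : (z - a) * (z - (starRingEnd ℂ) a) * (z - b) * (z - (starRingEnd ℂ) b) = 0 := by
      calc (z - a) * (z - (starRingEnd ℂ) a) * (z - b) * (z - (starRingEnd ℂ) b)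
          = (z - a) * (z - (starRingEnd ℂ) a) * (z - (starRingEnd ℂ) b) * (z - b) := by ring
        _ = 0 := by rw [hD, zero_mul]
    simp [hD, this]
  · field_simp
    try ring

/-- **`𝓑_ℍ(a;b)²` in closed form**: `bCHI a b ^ 2 = (|b-ā| - |b-a|)/(|b-ā| + |b-a|)`
`= 4 Im a Im b/(|b-ā|+|b-a|)²` for `a, b ∈ ℍ` (CHI15 §2.7.2: `𝓑_ℍ(a;b) = (4 Im a Im b)^{1/2}/(|b-ā|+|b-a|)`).
[cite: ChelkakHonglerIzyurovAnnals2015, §2.7.2 (formula for 𝓑_ℍ(a;b)) and eq. (1.3)] -/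
theorem bCHI_sq (ha : 0 < a.im) (hb : 0 < b.im) (hab : a ≠ b) :
    bCHI a b ^ 2 = (‖b - (starRingEnd ℂ) a‖ - ‖b - a‖) / (‖b - (starRingEnd ℂ) a‖ + ‖b - a‖) := by
  obtain ⟨-, h2, -, h4, -, hS⟩ := spinor_ne_zero_aux ha hb hab
  have hP : 0 < ‖b - a‖ := norm_pos_iff.2 h2
  have hR : 0 < ‖b - (starRingEnd ℂ) a‖ := norm_pos_iff.2 h4
  have hlt := norm_sub_lt_norm_sub_conj ha hb
  set P := ‖b - a‖ with hPdef
  set R := ‖b - (starRingEnd ℂ) a‖ with hRdef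
  have hu : uCHI a b = Real.sqrt (P / R) := by
    unfold uCHI; rw [Real.sqrt_eq_rpow]
  have hu0 : 0 < uCHI a b := by rw [hu]; exact Real.sqrt_pos.2 (div_pos hP hR)
  have hu2 : uCHI a b ^ 2 = P / R := by rw [hu, Real.sq_sqrt (div_pos hP hR).le]
  have hu1 : uCHI a b ≤ 1 := by
    by_contra h
    push Not at h
    have : 1 < uCHI a b ^ 2 := by nlinarith
    have h1 : uCHI a b ^ 2 ≤ 1 := by rw [hu2, div_le_one hR]; exact hlt.le
    linarith
  have hule : uCHI a b ≤ (uCHI a b)⁻¹ := hu1.trans ((one_le_inv₀ hu0).2 hu1)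
  unfold bCHI
  rw [div_pow, Real.sq_sqrt (sub_nonneg.2 hule), Real.sq_sqrt (by positivity)]
  have hu0' : uCHI a b ≠ 0 := hu0.ne'
  have e : ((uCHI a b)⁻¹ - uCHI a b) / (uCHI a b + (uCHI a b)⁻¹) = (1 - uCHI a b ^ 2) / (uCHI a b ^ 2 + 1) := by
    rw [div_eq_div_iff (by positivity) (by positivity)]
    field_simp
    try ring
  rw [e, hu2, div_eq_div_iff (by positivity) (by positivity)]
  field_simp
  try ring

/-- **(2.14) and the expansion at `b`.** The continuation of `(z-b) f(z)²` takes at `b` the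
non-positive real value `-𝓑_ℍ(a;b)²` ("`lim_{z→b} √(z-b) f ∈ iℝ`", squared, with modulus `𝓑_ℍ`:
CHI15 "looking at the asymptotic expansions at `b`, one obtains `𝓑_ℍ(a;b) = (4 Im a Im b)^{1/2}/(|b-ā|+|b-a|)`").
[cite: ChelkakHonglerIzyurovAnnals2015, Def. 2.8 eq. (2.14) and §2.7.2 (formula for 𝓑_ℍ)] -/
theorem spinorSqMulRight_right (ha : 0 < a.im) (hb : 0 < b.im) (hab : a ≠ b) :
    spinorSqMulRight a b b = -((bCHI a b ^ 2 : ℝ) : ℂ) := by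
  obtain ⟨h1, h2, h3, h4, h5, hS⟩ := spinor_ne_zero_aux ha hb hab
  have hS' : (((‖b - (starRingEnd ℂ) a‖ + ‖b - a‖) ^ 2 : ℝ) : ℂ) ≠ 0 := by
    exact_mod_cast (pow_pos hS 2).ne'
  have hS'' : ((‖b - (starRingEnd ℂ) a‖ + ‖b - a‖ : ℝ) : ℂ) ≠ 0 := by exact_mod_cast hS.ne'
  rw [bCHI_sq ha hb hab]
  unfold spinorSqMulRight spinorC2
  rw [spinorNumSq_right]
  have key := sub_conj_mul_sub_conj a b
  have e1 : (a - (starRingEnd ℂ) a) / ((((‖b - (starRingEnd ℂ) a‖ + ‖b - a‖) ^ 2 : ℝ)) : ℂ) *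
        ((b - a) * (b - (starRingEnd ℂ) a) * (b - (starRingEnd ℂ) b) ^ 2) /
        ((b - a) * (b - (starRingEnd ℂ) a) * (b - (starRingEnd ℂ) b)) =
      (a - (starRingEnd ℂ) a) * (b - (starRingEnd ℂ) b) /
        ((((‖b - (starRingEnd ℂ) a‖ + ‖b - a‖) ^ 2 : ℝ)) : ℂ) := by
    rw [eq_div_iff hS']
    field_simp
    try ring
  rw [e1, key]
  push_cast at hS'' ⊢
  rw [div_eq_iff (pow_ne_zero 2 hS'')]
  field_simp
  try ring

/-- **(2.14), limit form**: `(z-b) f_{[ℍ,a;b]}(z)² → -𝓑_ℍ(a;b)² ≤ 0` as `z → b`.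
[cite: ChelkakHonglerIzyurovAnnals2015, Def. 2.8 eq. (2.14) and §2.7.2] -/
theorem tendsto_spinorSqCHI_mul_sub_right (ha : 0 < a.im) (hb : 0 < b.im) (hab : a ≠ b) :
    Tendsto (fun z => spinorSqCHI a b z * (z - b)) (𝓝[≠] b) (𝓝 (-((bCHI a b ^ 2 : ℝ) : ℂ))) := by
  obtain ⟨h1, h2, h3, h4, h5, hS⟩ := spinor_ne_zero_aux ha hb hab
  have hcont : ContinuousAt (spinorSqMulRight a b) b := by
    unfold spinorSqMulRight spinorNumSq
    have hden : (b - a) * (b - (starRingEnd ℂ) a) * (b - (starRingEnd ℂ) b) ≠ 0 :=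
      mul_ne_zero (mul_ne_zero h2 h4) h5
    exact ContinuousAt.div (by fun_prop) (by fun_prop) hden
  have h := hcont.tendsto.mono_left (nhdsWithin_le_nhds (s := ({b}ᶜ : Set ℂ)))
  rw [spinorSqMulRight_right ha hb hab] at h
  refine h.congr' ?_
  filter_upwards [self_mem_nhdsWithin] with z hz
  exact (spinorSqCHI_mul_sub_right hz).symm

end Expansions

end Literature.Probability.LatticeModels
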